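import Summits.KontsevichZagierPeriods.KontsevichZagierPeriods.Theorems.HurwitzMicroSectorsNormalFormPrincipleSplitMoves

/-!
# `NormalFormPrinciple` (stmt-KontsevichZagierPeriods-3869), line `SketchIdeator1` — the registered
# sub-goal `nfA_pole_one` (algebraic-pole layer of the leaf `stub_boxRigidity`, dimension one)

Pure proof file (`--supports` the crux; siege attempt k3, variation "reduce to landed lemmas of the
crux, then assemble"). The sub-goal says: a representation `T = [(0,1), c/(x − ρ)]` with a SIMPLE
REAL ALGEBRAIC pole `ρ ∉ [0,1]` (`c`, `ρ` real algebraic) is, modulo `KZ.relations`, in the algebraic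
normal form "point + dlog carriers": `[T] ≡ [pt, r] + Σⱼ [(1,uⱼ), cⱼ/y]` with `r`, `uⱼ > 1`, `cⱼ`
real algebraic. Here ONE carrier suffices and `r = 0`:

* `ρ < 0`: the increasing affine chart `Φ y = (−ρ)·y + ρ` maps `(1, 1 − ρ⁻¹)` onto `(0,1)`, and
  `c/(Φ y − ρ)·|−ρ| = c/y`; so `[(1, 1 − ρ⁻¹), c/y] − [T]` is ONE rule-(2) move
  (`pole_carrier_sub_mem_relations_of_neg`);
* `1 < ρ`: the decreasing chart `Φ y = (1−ρ)·y + ρ` maps `(1, ρ/(ρ−1))` onto `(0,1)`, and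
  `c/(Φ y − ρ)·|1−ρ| = (−c)/y`; so `[(1, ρ/(ρ−1)), (−c)/y] − [T]` is ONE rule-(2) move
  (`pole_carrier_sub_mem_relations_of_one_lt`);
* `[pt, 0] ∈ relations` (`pt_zero_mem_relations`), and the identity in `FormalRep ⧸ relations`
  follows (`nfA_pole_one`).

The affine move with real ALGEBRAIC coefficients (`affineA_sub_mem_relations`) is the landed
`affine_sub_mem_relations` of `…SplitMoves.lean` with `s, t ∈ ℚ` replaced by real algebraic `s, t`
(the chart lemmas `aff_isSemialgebraicMapOn_chart`, `aff_hasFDerivAt_chart`, `aff_injective_chart` of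
`TerasomaMultiplicationBetaCancellationStubAffineMove.lean` already take algebraic coefficients), and
the slab images are `image_affine_slab_of_pos/neg` of `…SplitMoves.lean`.

Sources: M. Kontsevich, D. Zagier, *Periods* (2001), §1.2 rule (2). No definitions are introduced.
-/

noncomputable section

open MeasureTheory Set Finset
open Literature.NumberTheory.Transcendental Literature.NumberTheory.Transcendental.KZ
open Literature.ModelTheory.ExponentialFields (IsSemialgebraic)

namespace Summit.KontsevichZagierPeriods.HurwitzMicroSectors.NormalFormPrinciple.PiBox

namespace Dlog

namespace SiegeK3

open Summit.KontsevichZagierPeriods.KontsevichZagierPeriods.BetaCancellationLine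
  (aff_hasFDerivAt_chart aff_injective_chart aff_isSemialgebraicMapOn_chart)

/-! ## The affine move with real algebraic coefficients -/

/-- **Affine move with real algebraic coefficients** (rule 2), either orientation: if
`Φ(y) = s y + t` (`s ≠ 0`, `s, t` real algebraic) maps `N.domain` onto `L.domain` and `N`'s
integrand is the pull-back `f(Φ y)·|s|` of `L`'s integrand `f`, then `[N] − [L] ∈ relations`.
[cite: KontsevichZagier2001, §1.2 rule (2)] -/
theorem affineA_sub_mem_relations {s t : ℝ} (hsA : IsAlgebraic ℚ s) (htA : IsAlgebraic ℚ t)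
    (hs : s ≠ 0) (N L : IntegralRep 1) (f : ℝ → ℝ)
    (himage : L.domain = (fun y : Fin 1 → ℝ => fun _ : Fin 1 => s * y 0 + t) '' N.domain)
    (hLi : EqOn L.integrand (fun x => f (x 0)) L.domain)
    (hNi : EqOn N.integrand (fun x => f (s * x 0 + t) * |s|) N.domain) :
    of N - of L ∈ relations := by
  -- the Jacobian `|det (s • id_{ℝ¹})| = |s|` (as in `affine_sub_mem_relations`)
  have hdet : |(s • ContinuousLinearMap.id ℝ (Fin 1 → ℝ)).det| = |s| := by
    have : (s • ContinuousLinearMap.id ℝ (Fin 1 → ℝ)).det = s := by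
      change LinearMap.det ((s • ContinuousLinearMap.id ℝ (Fin 1 → ℝ) :
        (Fin 1 → ℝ) →L[ℝ] (Fin 1 → ℝ)) : (Fin 1 → ℝ) →ₗ[ℝ] (Fin 1 → ℝ)) = s
      rw [ContinuousLinearMap.toLinearMap_smul, ContinuousLinearMap.coe_id,
        LinearMap.det_smul, LinearMap.det_id, Module.finrank_fin_fun]
      ring
    rw [this]
  refine changeOfVariablesRel_subset_relations
    ⟨1, N, L, fun y : Fin 1 → ℝ => fun _ : Fin 1 => s * y 0 + t,
      fun _ => s • ContinuousLinearMap.id ℝ (Fin 1 → ℝ),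
      aff_isSemialgebraicMapOn_chart N.isSemialgebraic_domain htA hsA,
      fun x _ => (aff_hasFDerivAt_chart s t x).hasFDerivWithinAt,
      (aff_injective_chart hs t).injOn, himage, fun x hx => ?_, rfl⟩
  have hΦx : (fun _ : Fin 1 => s * x 0 + t) ∈ L.domain := himage ▸ Set.mem_image_of_mem _ hx
  rw [hNi hx, hLi hΦx, hdet]

/-! ## The two pole-carrier moves -/

/-- **Pole to the left** (`ρ < 0`): `[(1, 1 − ρ⁻¹), c/y] − [(0,1), c/(x − ρ)] ∈ relations`, by the
increasing affine chart `x = (−ρ) y + ρ` (Jacobian `−ρ`). [cite: KontsevichZagier2001, §1.2 rule (2)] -/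
theorem pole_carrier_sub_mem_relations_of_neg {RA : ℝ → ℝ → ℝ → IntegralRep 1}
    (hR : ∀ a b c, IsAlgebraic ℚ a → IsAlgebraic ℚ b → IsAlgebraic ℚ c → 0 < a →
      (RA a b c).domain = {x | x 0 ∈ Set.Ioo a b} ∧ (RA a b c).integrand = fun x => c / x 0)
    {c ρ : ℝ} (hc : IsAlgebraic ℚ c) (hρA : IsAlgebraic ℚ ρ) (hρ0 : ρ < 0) (T : IntegralRep 1)
    (hTd : T.domain = {x | x 0 ∈ Set.Ioo (0:ℝ) 1})
    (hTi : EqOn T.integrand (fun x => c / (x 0 - ρ)) T.domain) :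
    of (RA 1 (1 - ρ⁻¹) c) - of T ∈ relations := by
  have huA : IsAlgebraic ℚ (1 - ρ⁻¹) := isAlgebraic_one.sub hρA.inv
  obtain ⟨hNd, hNi⟩ := hR 1 (1 - ρ⁻¹) c isAlgebraic_one huA hc one_pos
  have hs0 : 0 < -ρ := neg_pos.mpr hρ0
  have hρne : ρ ≠ 0 := hρ0.ne
  refine affineA_sub_mem_relations hρA.neg hρA hs0.ne' (RA 1 (1 - ρ⁻¹) c) T
    (fun x => c / (x - ρ)) ?_ (fun x hx => hTi hx) fun x _ => ?_
  · -- the chart maps `(1, 1 − ρ⁻¹)` onto `(0,1)`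
    rw [hNd, image_affine_slab_of_pos hs0, hTd]
    have h1 : -ρ * 1 + ρ = 0 := by ring
    have h2 : -ρ * (1 - ρ⁻¹) + ρ = 1 := by field_simp; ring
    rw [h1, h2]
  · -- the pull-back identity `c/y = c/((−ρ) y + ρ − ρ)·|−ρ|` on `(1, 1 − ρ⁻¹)`
    rw [hNi, abs_of_pos hs0]
    show c / x 0 = c / (-ρ * x 0 + ρ - ρ) * -ρ
    rw [show -ρ * x 0 + ρ - ρ = x 0 * -ρ by ring, div_mul_eq_mul_div,
      mul_div_mul_right _ _ hs0.ne']

/-- **Pole to the right** (`1 < ρ`): `[(1, ρ/(ρ−1)), (−c)/y] − [(0,1), c/(x − ρ)] ∈ relations`, by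
the decreasing affine chart `x = (1−ρ) y + ρ` (Jacobian `|1−ρ| = ρ − 1`).
[cite: KontsevichZagier2001, §1.2 rule (2)] -/
theorem pole_carrier_sub_mem_relations_of_one_lt {RA : ℝ → ℝ → ℝ → IntegralRep 1}
    (hR : ∀ a b c, IsAlgebraic ℚ a → IsAlgebraic ℚ b → IsAlgebraic ℚ c → 0 < a →
      (RA a b c).domain = {x | x 0 ∈ Set.Ioo a b} ∧ (RA a b c).integrand = fun x => c / x 0)
    {c ρ : ℝ} (hc : IsAlgebraic ℚ c) (hρA : IsAlgebraic ℚ ρ) (hρ1 : 1 < ρ) (T : IntegralRep 1)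
    (hTd : T.domain = {x | x 0 ∈ Set.Ioo (0:ℝ) 1})
    (hTi : EqOn T.integrand (fun x => c / (x 0 - ρ)) T.domain) :
    of (RA 1 (ρ / (ρ - 1)) (-c)) - of T ∈ relations := by
  have huA : IsAlgebraic ℚ (ρ / (ρ - 1)) := by
    rw [div_eq_mul_inv]
    exact hρA.mul (hρA.sub isAlgebraic_one).inv
  obtain ⟨hNd, hNi⟩ := hR 1 (ρ / (ρ - 1)) (-c) isAlgebraic_one huA hc.neg one_pos
  have hs0 : 1 - ρ < 0 := by linarith
  have hρ1' : 0 < ρ - 1 := by linarith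
  refine affineA_sub_mem_relations (isAlgebraic_one.sub hρA) hρA hs0.ne (RA 1 (ρ / (ρ - 1)) (-c)) T
    (fun x => c / (x - ρ)) ?_ (fun x hx => hTi hx) fun x _ => ?_
  · -- the chart maps `(1, ρ/(ρ−1))` onto `(0,1)` (reversing the orientation)
    rw [hNd, image_affine_slab_of_neg hs0, hTd]
    have h1 : (1 - ρ) * (ρ / (ρ - 1)) + ρ = 0 := by field_simp; ring
    have h2 : (1 - ρ) * 1 + ρ = 1 := by ring
    rw [h1, h2]
  · -- the pull-back identity `(−c)/y = c/((1−ρ) y + ρ − ρ)·|1−ρ|` on `(1, ρ/(ρ−1))`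
    rw [hNi, abs_of_neg hs0]
    show -c / x 0 = c / ((1 - ρ) * x 0 + ρ - ρ) * -(1 - ρ)
    rw [show (1 - ρ) * x 0 + ρ - ρ = x 0 * (1 - ρ) by ring, div_mul_eq_mul_div,
      show c * -(1 - ρ) = -c * (1 - ρ) by ring, mul_div_mul_right _ _ hs0.ne]

/-! ## The registered sub-goal -/

/-- **Registered sub-goal `nfA_pole_one`** of crux stmt-KontsevichZagierPeriods-3869 (line
`SketchIdeator1`, algebraic-pole layer of the leaf `stub_boxRigidity` in dimension one): a simple real
algebraic pole off `[0,1]` is in algebraic normal form — `[(0,1), c/(x−ρ)] ≡ [pt, 0] + [(1,u), c'/y]`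
modulo `KZ.relations`, with ONE carrier: `(u, c') = (1 − ρ⁻¹, c)` if `ρ < 0` and
`(u, c') = (ρ/(ρ−1), −c)` if `1 < ρ` (one affine move each, `pole_carrier_sub_mem_relations_of_neg` /
`…_of_one_lt`), `u > 1` and `u, c'` real algebraic; `[pt, 0] ∈ relations`.
[cite: KontsevichZagier2001, §1.2 rules (1), (2)] -/
theorem nfA_pole_one {RA : ℝ → ℝ → ℝ → IntegralRep 1} {ZA : ℝ → IntegralRep 0} (hR : ∀ a b c, IsAlgebraic ℚ a → IsAlgebraic ℚ b → IsAlgebraic ℚ c → 0 < a → (RA a b c).domain = {x | x 0 ∈ Set.Ioo a b} ∧ (RA a b c).integrand = fun x => c / x 0) (hZ : ∀ r, IsAlgebraic ℚ r → (ZA r).domain = univ ∧ (ZA r).integrand = fun _ => r) {c ρ : ℝ} (hc : IsAlgebraic ℚ c) (hρA : IsAlgebraic ℚ ρ) (hρ : ρ ∉ Set.Icc (0:ℝ) 1) (T : IntegralRep 1) (hTd : T.domain = {x | x 0 ∈ Set.Ioo (0:ℝ) 1}) (hTi : EqOn T.integrand (fun x => c / (x 0 - ρ)) T.domain) : ∃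 (r : ℝ) (k : ℕ) (u c : Fin k → ℝ), IsAlgebraic ℚ r ∧ (∀ j, 1 < u j) ∧ (∀ j, IsAlgebraic ℚ (u j)) ∧ (∀ j, IsAlgebraic ℚ (c j)) ∧ QuotientAddGroup.mk' relations (of T) = QuotientAddGroup.mk' relations (of (ZA r)) + ∑ j, QuotientAddGroup.mk' relations (of (RA 1 (u j) (c j))) := by
  -- `ρ ∉ [0,1]`: the pole is to the left or to the right of the unit slab
  have hρ' : ρ < 0 ∨ 1 < ρ := by
    rcases lt_or_ge ρ 0 with h | h
    · exact Or.inl h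
    · exact Or.inr (not_le.mp fun h1 => hρ ⟨h, h1⟩)
  -- the point representation `[pt, 0]` is a relation
  have hZ0 : of (ZA 0) ∈ relations := pt_zero_mem_relations (ZA 0) (hZ 0 isAlgebraic_zero).2
  -- assembly in `FormalRep ⧸ relations` from ONE carrier `[(1,u), c'/y]` with `[RA 1 u c'] − [T] ∈ relations`
  suffices key : ∃ u c' : ℝ, 1 < u ∧ IsAlgebraic ℚ u ∧ IsAlgebraic ℚ c' ∧
      of (RA 1 u c') - of T ∈ relations by
    obtain ⟨u, c', hu1, huA, hcA, hrel⟩ := key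
    refine ⟨0, 1, fun _ => u, fun _ => c', isAlgebraic_zero, fun _ => hu1, fun _ => huA,
      fun _ => hcA, ?_⟩
    simp only [QuotientAddGroup.mk'_apply, Fin.sum_univ_one]
    rw [(QuotientAddGroup.eq_zero_iff _).mpr hZ0, zero_add, eq_comm, QuotientAddGroup.eq_iff_sub_mem]
    exact hrel
  rcases hρ' with hρ0 | hρ1
  · refine ⟨1 - ρ⁻¹, c, ?_, isAlgebraic_one.sub hρA.inv, hc,
      pole_carrier_sub_mem_relations_of_neg hR hc hρA hρ0 T hTd hTi⟩
    have : ρ⁻¹ < 0 := inv_lt_zero.mpr hρ0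
    linarith
  · refine ⟨ρ / (ρ - 1), -c, ?_, ?_, hc.neg,
      pole_carrier_sub_mem_relations_of_one_lt hR hc hρA hρ1 T hTd hTi⟩
    · rw [one_lt_div (by linarith : (0:ℝ) < ρ - 1)]
      linarith
    · rw [div_eq_mul_inv]
      exact hρA.mul (hρA.sub isAlgebraic_one).inv

end SiegeK3

end Dlog

end Summit.KontsevichZagierPeriods.HurwitzMicroSectors.NormalFormPrinciple.PiBox
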